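import Mathlib.GroupTheory.Commensurable
import Literature.AnabelianGeometry.SemiGraphs.ArithMaximalCompact
import Literature.AnabelianGeometry.SemiGraphs.TemperedEdgeInVerticialProofs
import Literature.AnabelianGeometry.SemiGraphs.TemperedVerticialNamedFactsProofs
import Literature.AnabelianGeometry.SemiGraphs.TemperedReconstructionReductionsProofs
import Literature.AnabelianGeometry.SemiGraphs.CommensurableTerminalityLemmas
import HarnessLib

/-!
# [SemiAnbd] §5 p.65: the decomposition data of Theorem 5.4 PRODUCED from the tempered chart
# (arithmetic decomposition groups as commensurators)

Mochizuki, *Semi-graphs of anabelioids*, Publ. RIMS **42** (2006), §5, manuscript p. 65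
(kurims `paper:url-f33ace170ff4`). [cite: MochizukiSemiAnbd2006, §5, p. 65]

`ArithMaximalCompact.lean` (abc-iut-L3-t3) types Def 5.3 / Rmk 5.3.1 / Thm 5.4 (i)(ii) over ABSTRACT
data `DecompositionData Gtp V B` ("chosen representatives of the decomposition groups
`Π^temp_{𝔊,v}`, `Π^temp_{𝔊,b}`") and an augmentation `aug : Gtp →* PA`.  This file (sub-DAG
`plan/L3/SUBDAG-SemiAnbd-Thm54.md`, row T54-0 PRODUCER, LEVEL A) PRODUCES such data from the §3
tempered chart of abc-iut-L3-t2's concrete presentation (`ProfiniteSemiGraph`, `TemperedPiChart`,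
`verticialSubgroups`, `edgeLikeSubgroups` — `TemperedCoverings.lean`, `TemperedVerticial.lean`),
following the printed description of the decomposition groups (p. 65):

> "for every vertex `v` of `𝔾`, we obtain an associated decomposition group
> `Π^temp_{𝔊,v} ⊆ Π^temp_𝔊` [well-defined up to conjugation in `Π^temp_𝔊`], which [by Corollary 2.7,
> (i), (iii); the injection of Proposition 3.6, (iii)] may be thought of as the commensurator in
> `Π^temp_𝔊` of `Π^temp_{𝔾,v} := Π^temp_{𝔊,v} ∩ Π^temp_𝔾`.  Similarly, if `b` is a branch of an edge `e`
> of `𝔾` that abuts to `v`, then we obtain a decomposition group `Π^temp_{𝔊,b} ⊆ Π^temp_{𝔊,v} ⊆ Π^temp_𝔊`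
> …, which … may be thought of as the commensurator in `Π^temp_{𝔊,v}` of
> `Π^temp_{𝔾,b} := Π^temp_{𝔊,b} ∩ Π^temp_𝔾`."

MODELLING DECISION (recorded, T54 coordinator ruling R10 / lead GO-A 2026-08-25): the arithmetic
tempered fundamental group `Π^temp_𝔊` of Prop 5.2 (iv) is NOT constructed in the tree (in
`ArithmeticCoverings.FundamentalExactSequences` all four groups are parameters), so here `Gtp` and the
inclusion `ι : Π^temp_𝔾 = c.G → Gtp` are PARAMETERS, and the decomposition groups are DEFINED by the
printed characterization: `Π^temp_{𝔊,v} :=` the commensurator in `Gtp` of `ι(Π^temp_{𝔾,v})` for a chosen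
verticial subgroup `Π^temp_{𝔾,v}` at `v` (Thm 3.7 (i)), and `Π^temp_{𝔊,b} := Π^temp_{𝔊,v} ∩` the
commensurator of `ι(Π^temp_{𝔾,b})` for a chosen edge-like subgroup `Π^temp_{𝔾,b} ⊆ Π^temp_{𝔾,v}` of the
edge of `b` (Thm 3.7 (iii)).  The identification of these commensurators with the covering-theoretic
decomposition groups is the content of the bracket "[Cor 2.7 (i), (iii); Prop 3.6 (iii)]" and is NOT
re-proved here.  Choices: `ChartRepresentatives` (any compatible choice; they exist for graphs of
injective type that are quasi-coherent and Galois-countable, `ChartRepresentatives.nonempty`; the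
verticial ones form one conjugacy class, `exists_conj_of_mem_verticialSubgroups`).

Contents: `ChartRepresentatives`, `arithVertGp`, `arithBrGp`, `decompositionDataOfChart` and
definitional bookkeeping (`…_abut`, `…_vertGp`, `…_brGp`, `abut_isSome_of_isGraph`,
`map_le_arithVertGp`, `arithBrGp_le_arithVertGp`).  The theorems ABOUT the produced data that the
other T54 rows consume as inline hypotheses (hγ, hVE, H-CT, hβ₁ of the coordinator's menu) are
proof-only companions.  Deliberately NOT here: a construction of `Π^temp_𝔊` itself (LEVEL B: the
centre-free extension `Π_A ×_{Out} Aut(Π^temp_𝔾)` via temp-slimness and Prop 3.6 (iv)), the arithmetic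
action of `Π_A` on the underlying semi-graph (Def 5.1 (i); it enters the companions as explicit
hypotheses), anything asserting a statement of the paper.  Typed ≠ proved; nothing here takes a side
on [IUTchIII] Cor 3.12.
-/

namespace Literature.AnabelianGeometry.SemiGraphs

open CategoryTheory Topology
open scoped Pointwise

universe u u'

namespace ProfiniteSemiGraph

variable {𝒢 : ProfiniteSemiGraph.{u}}

/-! ### Compatible representatives of the §3 verticial and edge-like subgroups -/

/-- A compatible choice of representatives of the §3 decomposition subgroups of `π₁^temp(G) = c.G`:
a verticial subgroup `Π^temp_{𝔾,v}` at every vertex (Thm 3.7 (i), "well-defined up to conjugation")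
and, for every branch `b`, an edge-like subgroup `Π^temp_{𝔾,b}` of the edge of `b` (Thm 3.7 (iii))
contained in the chosen verticial subgroup of the vertex `b` abuts to ("`Π^temp_{𝔊,b} ⊆ Π^temp_{𝔊,v}`",
p. 65). [cite: MochizukiSemiAnbd2006, §5, p. 65] -/
structure ChartRepresentatives (c : TemperedPiChart 𝒢) : Type u where
  /-- the chosen verticial subgroup at `v` -/
  Hv : 𝒢.graph.Vertex → Subgroup c.G
  /-- it is verticial at `v` -/
  Hv_mem : ∀ v, Hv v ∈ verticialSubgroups c v
  /-- the chosen edge-like subgroup attached to the branch `b` -/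
  Hb : 𝒢.graph.Branch → Subgroup c.G
  /-- it is edge-like for the edge of `b` -/
  Hb_mem : ∀ b, Hb b ∈ edgeLikeSubgroups c (𝒢.graph.edgeOf b)
  /-- compatibility along abutment: `Π^temp_{𝔾,b} ⊆ Π^temp_{𝔾,v}` -/
  Hb_le : ∀ (b : 𝒢.graph.Branch) (v : 𝒢.graph.Vertex), 𝒢.graph.abuts b = some v → Hb b ≤ Hv v

/-- **Compatible representatives exist** for a graph of anabelioids (every branch abuts to a vertex)
that is of injective type, quasi-coherent and Galois-countable: verticial subgroups exist at every
vertex (`verticialSubgroups_nonempty`, Thm 3.7 (i)), edge homomorphisms exist at every edge with an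
abutting branch (`exists_isEdgeHom`), and every edge-like subgroup is conjugate INTO any verticial
subgroup of an abutting vertex (`exists_conj_le_of_mem_edgeLikeSubgroups`), conjugates of edge-like
subgroups being edge-like (`conj_mem_edgeLikeSubgroups'`). [cite: MochizukiSemiAnbd2006, Thm 3.7 (i),(iii), pp. 40–41] -/
theorem ChartRepresentatives.nonempty (c : TemperedPiChart 𝒢) (hG : 𝒢.graph.IsGraph)
    (hqc : 𝒢.IsQuasiCoherent) (hgc : 𝒢.IsGaloisCountable) (hinj : 𝒢.IsOfInjectiveType) :
    Nonempty (ChartRepresentatives c) := by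
  classical
  -- verticial representatives
  let Hv : 𝒢.graph.Vertex → Subgroup c.G := fun v => (verticialSubgroups_nonempty hqc hgc c v).some
  have hHv : ∀ v, Hv v ∈ verticialSubgroups c v := fun v =>
    (verticialSubgroups_nonempty hqc hgc c v).some_mem
  -- for every branch: an edge-like subgroup inside the chosen verticial subgroup of its vertex
  have hb : ∀ b : 𝒢.graph.Branch, ∃ L : Subgroup c.G, L ∈ edgeLikeSubgroups c (𝒢.graph.edgeOf b) ∧
      ∀ v, 𝒢.graph.abuts b = some v → L ≤ Hv v := by
    intro b
    obtain ⟨v, hv⟩ := Option.isSome_iff_exists.mp (hG.abuts_isSome b)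
    obtain ⟨φ, hφ⟩ := exists_isEdgeHom hqc hgc hinj c b v hv
    have hL : φ.toMonoidHom.range ∈ edgeLikeSubgroups c (𝒢.graph.edgeOf b) := ⟨φ, hφ, rfl⟩
    obtain ⟨g, hg⟩ := exists_conj_le_of_mem_edgeLikeSubgroups c hv hL (hHv v)
    refine ⟨φ.toMonoidHom.range.map (MulAut.conj g).toMonoidHom,
      conj_mem_edgeLikeSubgroups' c hL g, fun w hw => ?_⟩
    rw [hv] at hw
    cases hw
    exact hg
  choose Hb hHb hHble using hb
  exact ⟨⟨Hv, hHv, Hb, hHb, fun b v h => hHble b v h⟩⟩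

/-! ### The produced decomposition data (p. 65) -/

variable {c : TemperedPiChart 𝒢} {Gtp : Type u'} [Group Gtp]

/-- **The arithmetic decomposition group of a vertex** (p. 65): "`Π^temp_{𝔊,v}` … may be thought of as
the commensurator in `Π^temp_𝔊` of `Π^temp_{𝔾,v}`" — the commensurator in `Gtp` (playing `Π^temp_𝔊`) of the
image under `ι : Π^temp_𝔾 → Π^temp_𝔊` of the chosen verticial subgroup at `v`.
[cite: MochizukiSemiAnbd2006, §5, p. 65] -/
def arithVertGp (R : ChartRepresentatives c) (ι : c.G →* Gtp) (v : 𝒢.graph.Vertex) : Subgroup Gtp :=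
  Subgroup.Commensurable.commensurator ((R.Hv v).map ι)

/-- **The arithmetic decomposition group of a branch** (p. 65): "`Π^temp_{𝔊,b} ⊆ Π^temp_{𝔊,v}` … may be
thought of as the commensurator in `Π^temp_{𝔊,v}` of `Π^temp_{𝔾,b}`" — the commensurator, inside the
vertex group of the vertex `b` abuts to (inside all of `Gtp` if `b` abuts to no vertex, a case excluded
by the frame of Thm 5.4: graphs of anabelioids), of the image of the chosen edge-like subgroup of `b`.
[cite: MochizukiSemiAnbd2006, §5, p. 65] -/
def arithBrGp (R : ChartRepresentatives c) (ι : c.G →* Gtp) (b : 𝒢.graph.Branch) : Subgroup Gtp :=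
  ((𝒢.graph.abuts b).map (arithVertGp R ι)).getD ⊤ ⊓
    Subgroup.Commensurable.commensurator ((R.Hb b).map ι)

/-- `arithBrGp` at a branch abutting to `v`, unfolded. [cite: MochizukiSemiAnbd2006, §5, p. 65] -/
theorem arithBrGp_of_abuts (R : ChartRepresentatives c) (ι : c.G →* Gtp) {b : 𝒢.graph.Branch}
    {v : 𝒢.graph.Vertex} (h : 𝒢.graph.abuts b = some v) :
    arithBrGp R ι b =
      arithVertGp R ι v ⊓ Subgroup.Commensurable.commensurator ((R.Hb b).map ι) := by
  rw [arithBrGp, h, Option.map_some, Option.getD_some]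

/-- "`Π^temp_{𝔊,b} ⊆ Π^temp_{𝔊,v}`" when `b` abuts to `v` (p. 65) — by construction.
[cite: MochizukiSemiAnbd2006, §5, p. 65] -/
theorem arithBrGp_le_arithVertGp (R : ChartRepresentatives c) (ι : c.G →* Gtp) {b : 𝒢.graph.Branch}
    {v : 𝒢.graph.Vertex} (h : 𝒢.graph.abuts b = some v) : arithBrGp R ι b ≤ arithVertGp R ι v := by
  rw [arithBrGp_of_abuts R ι h]
  exact inf_le_left

/-- `ι(Π^temp_{𝔾,v}) ⊆ Π^temp_{𝔊,v}` (p. 65: `Π^temp_{𝔾,v} = Π^temp_{𝔊,v} ∩ Π^temp_𝔾`, one inclusion).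
[cite: MochizukiSemiAnbd2006, §5, p. 65] -/
theorem map_le_arithVertGp (R : ChartRepresentatives c) (ι : c.G →* Gtp) (v : 𝒢.graph.Vertex) :
    (R.Hv v).map ι ≤ arithVertGp R ι v :=
  le_commensurator_self _

/-- `ι(Π^temp_{𝔾,b}) ⊆ Π^temp_{𝔊,b}` for a branch abutting to a vertex (p. 65, one inclusion).
[cite: MochizukiSemiAnbd2006, §5, p. 65] -/
theorem map_le_arithBrGp (R : ChartRepresentatives c) (ι : c.G →* Gtp) {b : 𝒢.graph.Branch}
    {v : 𝒢.graph.Vertex} (h : 𝒢.graph.abuts b = some v) : (R.Hb b).map ι ≤ arithBrGp R ι b := by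
  rw [arithBrGp_of_abuts R ι h]
  exact le_inf ((Subgroup.map_mono (R.Hb_le b v h)).trans (map_le_arithVertGp R ι v))
    (le_commensurator_self _)

/-- **T54-0 PRODUCER.**  The `DecompositionData` of `ArithMaximalCompact.lean` (the frame of [SemiAnbd]
Def 5.3 / Thm 5.4) produced from the tempered chart `c` of the concrete presentation `𝒢`, a compatible
choice `R` of §3 representatives and the inclusion `ι : Π^temp_𝔾 → Π^temp_𝔊 =: Gtp` (Prop 5.2 (iv),
a parameter): vertices, branches, edges and abutment are those of the underlying semi-graph, and the
decomposition groups are the commensurators of p. 65 (`arithVertGp`, `arithBrGp`).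
[cite: MochizukiSemiAnbd2006, §5, p. 65] -/
def decompositionDataOfChart (R : ChartRepresentatives c) (ι : c.G →* Gtp) :
    DecompositionData Gtp 𝒢.graph.Vertex 𝒢.graph.Branch where
  E := 𝒢.graph.Edge
  edgeOf := 𝒢.graph.edgeOf
  abut := 𝒢.graph.abuts
  vertGp := arithVertGp R ι
  brGp := arithBrGp R ι
  brGp_le_vertGp _ _ h := arithBrGp_le_arithVertGp R ι h

/-- The produced abutment map is that of the underlying semi-graph. [cite: MochizukiSemiAnbd2006, §5, p. 65] -/
@[simp] theorem decompositionDataOfChart_abut (R : ChartRepresentatives c) (ι : c.G →* Gtp) :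
    (decompositionDataOfChart R ι).abut = 𝒢.graph.abuts := rfl

/-- The produced edge map is that of the underlying semi-graph. [cite: MochizukiSemiAnbd2006, §5, p. 65] -/
@[simp] theorem decompositionDataOfChart_edgeOf (R : ChartRepresentatives c) (ι : c.G →* Gtp) :
    (decompositionDataOfChart R ι).edgeOf = 𝒢.graph.edgeOf := rfl

/-- The produced vertex groups are the commensurators `arithVertGp`. [cite: MochizukiSemiAnbd2006, §5, p. 65] -/
@[simp] theorem decompositionDataOfChart_vertGp (R : ChartRepresentatives c) (ι : c.G →* Gtp) :
    (decompositionDataOfChart R ι).vertGp = arithVertGp R ι := rfl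

/-- The produced branch groups are `arithBrGp`. [cite: MochizukiSemiAnbd2006, §5, p. 65] -/
@[simp] theorem decompositionDataOfChart_brGp (R : ChartRepresentatives c) (ι : c.G →* Gtp) :
    (decompositionDataOfChart R ι).brGp = arithBrGp R ι := rfl

/-- Menu item `habuts` for the produced data: in a GRAPH of anabelioids (the frame of Thm 5.4; [IUTchI]
Rmk 2.5.3 (iii)) every branch abuts to a vertex. [cite: MochizukiSemiAnbd2006, Thm 5.4, p. 66] -/
theorem abut_isSome_of_isGraph (R : ChartRepresentatives c) (ι : c.G →* Gtp) (hG : 𝒢.graph.IsGraph)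
    (b : 𝒢.graph.Branch) : ∃ v, (decompositionDataOfChart R ι).abut b = some v :=
  Option.isSome_iff_exists.mp (hG.abuts_isSome b)

/-- The commensurator (`C_G(H)`, [SemiAnbd] §0 "Topological groups", p. 5) is conjugation-equivariant:
`C_G(g H g⁻¹) = g · C_G(H) · g⁻¹`. [cite: MochizukiSemiAnbd2006, §0, p. 5] -/
theorem commensurator_conjSubgroup {G : Type*} [Group G] (H : Subgroup G) (g : G) :
    Subgroup.Commensurable.commensurator (conjSubgroup g H) =
      conjSubgroup g (Subgroup.Commensurable.commensurator H) := by
  have hconj : ∀ (x : G) (K : Subgroup G), conjSubgroup x K = ConjAct.toConjAct x • K := fun x K => rfl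
  ext x
  rw [hconj, hconj, Subgroup.Commensurable.commensurator_mem_iff,
    Subgroup.mem_pointwise_smul_iff_inv_smul_mem, Subgroup.Commensurable.commensurator_mem_iff,
    Subgroup.Commensurable.commensurable_conj (ConjAct.toConjAct g)
      (H := ConjAct.toConjAct ((ConjAct.toConjAct g)⁻¹ • x) • H) (K := H),
    smul_smul, smul_smul, ← map_mul, ← map_mul]
  have hx : g * ((ConjAct.toConjAct g)⁻¹ • x) = x * g := by
    rw [← map_inv, ConjAct.smul_def, ConjAct.ofConjAct_toConjAct]; group
  rw [hx]

/-- The verticial subgroups (Def 5.3 (iii)) of the produced data are exactly the conjugates of the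
commensurators of the images of the §3 verticial subgroups — for ANY member of `verticialSubgroups c v`,
not only the chosen representative (the representatives at `v` form one conjugacy class in `Π^temp_𝔾`,
`exists_conj_of_mem_verticialSubgroups`, and commensurators are conjugation-equivariant): the produced
notion "verticial" does not depend on the choice `R`. [cite: MochizukiSemiAnbd2006, Def 5.3 (iii), p. 65] -/
theorem isVerticial_decompositionDataOfChart_iff (R : ChartRepresentatives c) (ι : c.G →* Gtp)
    (K : Subgroup Gtp) :
    IsVerticial (decompositionDataOfChart R ι) K ↔
      ∃ (v : 𝒢.graph.Vertex) (H : Subgroup c.G) (g : Gtp), H ∈ verticialSubgroups c v ∧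
        K = conjSubgroup g (Subgroup.Commensurable.commensurator (H.map ι)) := by
  constructor
  · rintro ⟨v, g, rfl⟩
    exact ⟨v, R.Hv v, g, R.Hv_mem v, rfl⟩
  · rintro ⟨v, H, g, hH, rfl⟩
    -- `H = h · Hv v · h⁻¹` for some `h ∈ Π^temp_𝔾`
    obtain ⟨h, rfl⟩ := exists_conj_of_mem_verticialSubgroups c (R.Hv_mem v) hH
    refine ⟨v, g * ι h, ?_⟩
    have hmap : ((R.Hv v).map (MulAut.conj h).toMonoidHom).map ι = conjSubgroup (ι h) ((R.Hv v).map ι) := by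
      rw [conjSubgroup, Subgroup.map_map, Subgroup.map_map]
      congr 1
      ext x
      simp [MulAut.conj_apply]
    change conjSubgroup g (Subgroup.Commensurable.commensurator (((R.Hv v).map _).map ι)) =
      conjSubgroup (g * ι h) (Subgroup.Commensurable.commensurator ((R.Hv v).map ι))
    rw [hmap, commensurator_conjSubgroup, conjSubgroup, conjSubgroup, conjSubgroup, Subgroup.map_map]
    congr 1
    ext x
    simp [MulAut.conj_apply, mul_assoc]

end ProfiniteSemiGraph

end Literature.AnabelianGeometry.SemiGraphs
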